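import Literature.MathematicalPhysics.KineticTheory.EvenPolynomialPotentials
import Literature.MathematicalPhysics.KineticTheory.ZeroWavenumberSpace
import HarnessLib

/-!
# Polynomial Lipschitz bounds for the generators `j₀`, `h₀` of the infinite chain

Topic `Literature/MathematicalPhysics/KineticTheory` (companion of `InfiniteChainFlowLocality`, whose
pointwise locality estimate `InfiniteChainDynamics.exists_abs_sub_comp_severedFlow_le` takes as
hypothesis an observable `a` that is POLYNOMIALLY LIPSCHITZ in the coordinates at the sites
`-1, 0, 1`: if the coordinates of `σ'` there are bounded by `R ≥ 1` and those of `σ` are within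
`δ ≤ 1` of them, then `|a σ - a σ'| ≤ C_a R^{d_a} δ`). For `U`, `V` even non-negative polynomials
(`IsEvenPolyOfDegree`, degrees `2s₁`, `2s₂`) the two generators of Doyon's local observables have
this property: the bond current `j₀ = -½(p₀ + p₁) V'(q₁ - q₀)` with `d = 2s₂ + 1`
(`exists_polyLipschitz_bondCurrentZ`) and the energy density
`h₀ = ½p₀² + U(q₀) + ½[V(q₁ - q₀) + V(q₀ - q₋₁)]` with `d = 2s₁ + 2s₂ + 1`
(`exists_polyLipschitz_energyDensityZ`), from the mean-value bounds of `EvenPolynomialPotentials`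
(`exists_abs_sub_le`, `exists_abs_deriv_le`, `exists_abs_deriv_sub_deriv_le`). Everything is proved;
tagged `[folklore]`. No definitions, no named facts.
-/

noncomputable section

open Set Function

namespace Literature.MathematicalPhysics.KineticTheory.HeatConduction

namespace OscillatorChain

variable {P : OscillatorChain} {s₁ s₂ : ℕ}

/-! ### Elementary power bookkeeping -/

/-- `|x|^e ≤ Y^d` when `|x| ≤ Y`, `1 ≤ Y`, `e ≤ d`. [folklore] -/
theorem abs_pow_le_pow_of_le {x Y : ℝ} {e d : ℕ} (hx : |x| ≤ Y) (hY : 1 ≤ Y) (hed : e ≤ d) :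
    |x| ^ e ≤ Y ^ d :=
  (pow_le_pow_left₀ (abs_nonneg x) hx e).trans (pow_le_pow_right₀ hY hed)

/-- `1 + |x|^e + |y|^e ≤ 3 Y^d` when `|x|, |y| ≤ Y`, `1 ≤ Y`, `e ≤ d`. [folklore] -/
theorem one_add_abs_pow_add_le {x y Y : ℝ} {e d : ℕ} (hx : |x| ≤ Y) (hy : |y| ≤ Y) (hY : 1 ≤ Y)
    (hed : e ≤ d) : 1 + |x| ^ e + |y| ^ e ≤ 3 * Y ^ d := by
  have h1 : (1 : ℝ) ≤ Y ^ d := one_le_pow₀ hY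
  have h2 := abs_pow_le_pow_of_le hx hY hed
  have h3 := abs_pow_le_pow_of_le hy hY hed
  linarith

/-! ### The bond current -/

/-- **The bond current is polynomially Lipschitz in the coordinates at `0, 1`.** For `V` an even
non-negative polynomial of degree `2s₂` there is `C ≥ 0` such that, whenever the coordinates of
`σ'` at the sites `-1, 0, 1` are bounded by `R ≥ 1` and those of `σ` are within `δ ∈ [0, 1]` of
them, `|j₀(σ) - j₀(σ')| ≤ C R^{2s₂+1} δ`. [folklore] -/
theorem exists_polyLipschitz_bondCurrentZ (hV1 : IsEvenPolyOfDegree P.V s₂) :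
    ∃ C : ℝ, 0 ≤ C ∧ ∀ (σ σ' : ChainConfig) (R δ : ℝ), 1 ≤ R → 0 ≤ δ → δ ≤ 1 →
      (∀ i : ℤ, -1 ≤ i → i ≤ 1 → |(σ' i).1| ≤ R ∧ |(σ' i).2| ≤ R ∧
        |(σ i).1 - (σ' i).1| ≤ δ ∧ |(σ i).2 - (σ' i).2| ≤ δ) →
      |P.bondCurrentZ σ 0 - P.bondCurrentZ σ' 0| ≤ C * R ^ (2 * s₂ + 1) * δ := by
  obtain ⟨C₁, hC₁, hLip⟩ := hV1.exists_abs_deriv_sub_deriv_le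
  obtain ⟨C₂, hC₂, hder⟩ := hV1.exists_abs_deriv_le
  refine ⟨(6 * C₁ + 2 * C₂) * 4 ^ (2 * s₂ + 1), by positivity, ?_⟩
  intro σ σ' R δ hR hδ0 hδ1 h
  obtain ⟨hq0, hp0, hdq0, hdp0⟩ := h 0 (by norm_num) (by norm_num)
  obtain ⟨hq1, hp1, hdq1, hdp1⟩ := h (0 + 1) (by norm_num) (by norm_num)
  -- notation
  set m : ℝ := ((σ 0).2 + (σ (0 + 1)).2) / 2 with hm
  set m' : ℝ := ((σ' 0).2 + (σ' (0 + 1)).2) / 2 with hm'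
  set r : ℝ := (σ (0 + 1)).1 - (σ 0).1 with hr
  set r' : ℝ := (σ' (0 + 1)).1 - (σ' 0).1 with hr'
  set Y : ℝ := 4 * R with hY
  have hY1 : 1 ≤ Y := by rw [hY]; linarith
  have hY0 : 0 ≤ Y := zero_le_one.trans hY1
  -- sizes
  have hm'le : |m'| ≤ Y := by
    rw [hm', abs_div, abs_of_pos (by norm_num : (0 : ℝ) < 2)]
    have := abs_add_le (σ' 0).2 (σ' (0 + 1)).2
    rw [div_le_iff₀ (by norm_num : (0 : ℝ) < 2), hY]; linarith
  have hmm' : |m - m'| ≤ δ := by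
    have e : m - m' = (((σ 0).2 - (σ' 0).2) + ((σ (0 + 1)).2 - (σ' (0 + 1)).2)) / 2 := by
      rw [hm, hm']; ring
    rw [e, abs_div, abs_of_pos (by norm_num : (0 : ℝ) < 2), div_le_iff₀ (by norm_num : (0 : ℝ) < 2)]
    have := abs_add_le ((σ 0).2 - (σ' 0).2) ((σ (0 + 1)).2 - (σ' (0 + 1)).2)
    linarith
  have hmle : |m| ≤ Y := by
    have : |m| ≤ |m'| + |m - m'| := by
      have := abs_add_le m' (m - m'); rwa [add_sub_cancel] at this
    have hR4 : |m'| ≤ 2 * R := by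
      rw [hm', abs_div, abs_of_pos (by norm_num : (0 : ℝ) < 2)]
      have := abs_add_le (σ' 0).2 (σ' (0 + 1)).2
      rw [div_le_iff₀ (by norm_num : (0 : ℝ) < 2)]; linarith
    rw [hY]; linarith
  have hr'le : |r'| ≤ Y := by
    rw [hr']
    have := abs_sub (σ' (0 + 1)).1 (σ' 0).1
    rw [hY]; linarith
  have hrr' : |r - r'| ≤ 2 * δ := by
    have e : r - r' = ((σ (0 + 1)).1 - (σ' (0 + 1)).1) - ((σ 0).1 - (σ' 0).1) := by rw [hr, hr']; ring
    rw [e]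
    have := abs_sub ((σ (0 + 1)).1 - (σ' (0 + 1)).1) ((σ 0).1 - (σ' 0).1)
    linarith
  have hrle : |r| ≤ Y := by
    have : |r| ≤ |r'| + |r - r'| := by
      have := abs_add_le r' (r - r'); rwa [add_sub_cancel] at this
    have hR2 : |r'| ≤ 2 * R := by
      rw [hr']
      have := abs_sub (σ' (0 + 1)).1 (σ' 0).1
      linarith
    rw [hY]; linarith
  -- the two polynomial factors
  have hV'diff : |deriv P.V r - deriv P.V r'| ≤ 6 * C₁ * Y ^ (2 * s₂) * δ := by
    have h1 := hLip r r'
    have h2 : 1 + |r| ^ (2 * s₂ - 2) + |r'| ^ (2 * s₂ - 2) ≤ 3 * Y ^ (2 * s₂) :=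
      one_add_abs_pow_add_le hrle hr'le hY1 (by omega)
    calc |deriv P.V r - deriv P.V r'| ≤ C₁ * (1 + |r| ^ (2 * s₂ - 2) + |r'| ^ (2 * s₂ - 2)) * |r - r'| := h1
      _ ≤ C₁ * (3 * Y ^ (2 * s₂)) * (2 * δ) :=
          mul_le_mul (mul_le_mul_of_nonneg_left h2 hC₁) hrr' (abs_nonneg _) (by positivity)
      _ = 6 * C₁ * Y ^ (2 * s₂) * δ := by ring
  have hV'r' : |deriv P.V r'| ≤ 2 * C₂ * Y ^ (2 * s₂) := by
    have h1 := hder r'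
    have h2 : |r'| ^ (2 * s₂ - 1) ≤ Y ^ (2 * s₂) := abs_pow_le_pow_of_le hr'le hY1 (by omega)
    have h3 : (1 : ℝ) ≤ Y ^ (2 * s₂) := one_le_pow₀ hY1
    calc |deriv P.V r'| ≤ C₂ * (1 + |r'| ^ (2 * s₂ - 1)) := h1
      _ ≤ C₂ * (2 * Y ^ (2 * s₂)) := mul_le_mul_of_nonneg_left (by linarith) hC₂
      _ = 2 * C₂ * Y ^ (2 * s₂) := by ring
  -- the difference of the currents
  have hj : P.bondCurrentZ σ 0 - P.bondCurrentZ σ' 0 =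
      -(m * (deriv P.V r - deriv P.V r') + (m - m') * deriv P.V r') := by
    simp only [bondCurrentZ, hm, hm', hr, hr']
    ring
  rw [hj, abs_neg]
  have hYpow : Y ^ (2 * s₂) * Y = Y ^ (2 * s₂ + 1) := by rw [pow_succ]
  calc |m * (deriv P.V r - deriv P.V r') + (m - m') * deriv P.V r'|
      ≤ |m| * |deriv P.V r - deriv P.V r'| + |m - m'| * |deriv P.V r'| := by
        have := abs_add_le (m * (deriv P.V r - deriv P.V r')) ((m - m') * deriv P.V r')
        rw [abs_mul, abs_mul] at this
        exact this
    _ ≤ Y * (6 * C₁ * Y ^ (2 * s₂) * δ) + δ * (2 * C₂ * Y ^ (2 * s₂)) :=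
        add_le_add (mul_le_mul hmle hV'diff (abs_nonneg _) hY0)
          (mul_le_mul hmm' hV'r' (abs_nonneg _) hδ0)
    _ ≤ Y * (6 * C₁ * Y ^ (2 * s₂) * δ) + δ * (2 * C₂ * (Y ^ (2 * s₂) * Y)) := by
        have h1 : Y ^ (2 * s₂) ≤ Y ^ (2 * s₂) * Y := le_mul_of_one_le_right (by positivity) hY1
        have h2 : δ * (2 * C₂ * Y ^ (2 * s₂)) ≤ δ * (2 * C₂ * (Y ^ (2 * s₂) * Y)) :=
          mul_le_mul_of_nonneg_left (mul_le_mul_of_nonneg_left h1 (by positivity)) hδ0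
        linarith
    _ = (6 * C₁ + 2 * C₂) * Y ^ (2 * s₂ + 1) * δ := by rw [← hYpow]; ring
    _ = (6 * C₁ + 2 * C₂) * 4 ^ (2 * s₂ + 1) * R ^ (2 * s₂ + 1) * δ := by rw [hY, mul_pow]; ring

/-! ### The energy density -/

/-- **The energy density is polynomially Lipschitz in the coordinates at `-1, 0, 1`.** For `U`, `V`
even non-negative polynomials of degrees `2s₁`, `2s₂` there is `C ≥ 0` such that, whenever the
coordinates of `σ'` at the sites `-1, 0, 1` are bounded by `R ≥ 1` and those of `σ` are within
`δ ∈ [0, 1]` of them, `|h₀(σ) - h₀(σ')| ≤ C R^{2s₁+2s₂+1} δ`. [folklore] -/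
theorem exists_polyLipschitz_energyDensityZ (hU1 : IsEvenPolyOfDegree P.U s₁)
    (hV1 : IsEvenPolyOfDegree P.V s₂) :
    ∃ C : ℝ, 0 ≤ C ∧ ∀ (σ σ' : ChainConfig) (R δ : ℝ), 1 ≤ R → 0 ≤ δ → δ ≤ 1 →
      (∀ i : ℤ, -1 ≤ i → i ≤ 1 → |(σ' i).1| ≤ R ∧ |(σ' i).2| ≤ R ∧
        |(σ i).1 - (σ' i).1| ≤ δ ∧ |(σ i).2 - (σ' i).2| ≤ δ) →
      |P.energyDensityZ σ 0 - P.energyDensityZ σ' 0| ≤ C * R ^ (2 * s₁ + 2 * s₂ + 1) * δ := by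
  obtain ⟨CU, hCU, hUL⟩ := hU1.exists_abs_sub_le
  obtain ⟨CV, hCV, hVL⟩ := hV1.exists_abs_sub_le
  refine ⟨(2 + 3 * CU + 6 * CV) * 4 ^ (2 * s₁ + 2 * s₂ + 1), by positivity, ?_⟩
  intro σ σ' R δ hR hδ0 hδ1 h
  obtain ⟨hq0, hp0, hdq0, hdp0⟩ := h 0 (by norm_num) (by norm_num)
  obtain ⟨hq1, hp1, hdq1, hdp1⟩ := h (0 + 1) (by norm_num) (by norm_num)
  obtain ⟨hqm, hpm, hdqm, hdpm⟩ := h (0 - 1) (by norm_num) (by norm_num)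
  set Y : ℝ := 4 * R with hY
  have hY1 : 1 ≤ Y := by rw [hY]; linarith
  have hY0 : 0 ≤ Y := zero_le_one.trans hY1
  have hRY : R ≤ Y := by rw [hY]; linarith
  set d : ℕ := 2 * s₁ + 2 * s₂ + 1 with hd
  have hYd1 : (1 : ℝ) ≤ Y ^ d := one_le_pow₀ hY1
  -- generic bounds: a coordinate of `σ` is within `1` of that of `σ'`
  have near : ∀ {x x' : ℝ}, |x'| ≤ R → |x - x'| ≤ δ → |x| ≤ 2 * R := by
    intro x x' hx' hxx'
    have := abs_add_le x' (x - x'); rw [add_sub_cancel] at this; linarith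
  -- kinetic term
  have hkin : |(σ 0).2 ^ 2 / 2 - (σ' 0).2 ^ 2 / 2| ≤ 2 * Y ^ d * δ := by
    have e : (σ 0).2 ^ 2 / 2 - (σ' 0).2 ^ 2 / 2 = ((σ 0).2 - (σ' 0).2) * (((σ 0).2 + (σ' 0).2) / 2) := by
      ring
    rw [e, abs_mul]
    have hYd : Y ≤ Y ^ d := by
      calc Y = Y ^ 1 := (pow_one Y).symm
        _ ≤ Y ^ d := pow_le_pow_right₀ hY1 (by omega)
    have h1 : |((σ 0).2 + (σ' 0).2) / 2| ≤ 2 * Y ^ d := by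
      rw [abs_div, abs_of_pos (by norm_num : (0 : ℝ) < 2), div_le_iff₀ (by norm_num : (0 : ℝ) < 2)]
      have h2 := abs_add_le (σ 0).2 (σ' 0).2
      have h3 := near hp0 hdp0
      linarith
    calc |(σ 0).2 - (σ' 0).2| * |((σ 0).2 + (σ' 0).2) / 2| ≤ δ * (2 * Y ^ d) :=
          mul_le_mul hdp0 h1 (abs_nonneg _) hδ0
      _ = 2 * Y ^ d * δ := by ring
  -- pinning term
  have hpin : |P.U (σ 0).1 - P.U (σ' 0).1| ≤ 3 * CU * Y ^ d * δ := by
    have h1 := hUL (σ 0).1 (σ' 0).1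
    have hx : |(σ 0).1| ≤ Y := (near hq0 hdq0).trans (by rw [hY]; linarith)
    have hx' : |(σ' 0).1| ≤ Y := hq0.trans hRY
    have h2 : 1 + |(σ 0).1| ^ (2 * s₁ - 1) + |(σ' 0).1| ^ (2 * s₁ - 1) ≤ 3 * Y ^ d :=
      one_add_abs_pow_add_le hx hx' hY1 (by omega)
    calc |P.U (σ 0).1 - P.U (σ' 0).1|
        ≤ CU * (1 + |(σ 0).1| ^ (2 * s₁ - 1) + |(σ' 0).1| ^ (2 * s₁ - 1)) * |(σ 0).1 - (σ' 0).1| := h1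
      _ ≤ CU * (3 * Y ^ d) * δ := mul_le_mul (mul_le_mul_of_nonneg_left h2 hCU) hdq0 (abs_nonneg _) (by positivity)
      _ = 3 * CU * Y ^ d * δ := by ring
  -- bond terms
  have hbond : ∀ {a a' b b' : ℝ}, |a'| ≤ R → |b'| ≤ R → |a - a'| ≤ δ → |b - b'| ≤ δ →
      |P.V (a - b) - P.V (a' - b')| ≤ 6 * CV * Y ^ d * δ := by
    intro a a' b b' ha' hb' haa' hbb'
    have h1 := hVL (a - b) (a' - b')
    have hx' : |a' - b'| ≤ Y := by
      have := abs_sub a' b'; rw [hY]; linarith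
    have hdiff : |(a - b) - (a' - b')| ≤ 2 * δ := by
      have e : (a - b) - (a' - b') = (a - a') - (b - b') := by ring
      rw [e]; have := abs_sub (a - a') (b - b'); linarith
    have hx : |a - b| ≤ Y := by
      have := abs_add_le (a' - b') ((a - b) - (a' - b')); rw [add_sub_cancel] at this
      have h2 : |a' - b'| ≤ 2 * R := by have := abs_sub a' b'; linarith
      rw [hY]; linarith
    have h2 : 1 + |a - b| ^ (2 * s₂ - 1) + |a' - b'| ^ (2 * s₂ - 1) ≤ 3 * Y ^ d :=
      one_add_abs_pow_add_le hx hx' hY1 (by omega)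
    calc |P.V (a - b) - P.V (a' - b')|
        ≤ CV * (1 + |a - b| ^ (2 * s₂ - 1) + |a' - b'| ^ (2 * s₂ - 1)) * |(a - b) - (a' - b')| := h1
      _ ≤ CV * (3 * Y ^ d) * (2 * δ) :=
          mul_le_mul (mul_le_mul_of_nonneg_left h2 hCV) hdiff (abs_nonneg _) (by positivity)
      _ = 6 * CV * Y ^ d * δ := by ring
  have hb1 := hbond hq1 hq0 hdq1 hdq0
  have hb2 := hbond hq0 hqm hdq0 hdqm
  -- assemble
  have he : P.energyDensityZ σ 0 - P.energyDensityZ σ' 0 =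
      ((σ 0).2 ^ 2 / 2 - (σ' 0).2 ^ 2 / 2) + (P.U (σ 0).1 - P.U (σ' 0).1) +
        ((P.V ((σ (0 + 1)).1 - (σ 0).1) - P.V ((σ' (0 + 1)).1 - (σ' 0).1)) +
          (P.V ((σ 0).1 - (σ (0 - 1)).1) - P.V ((σ' 0).1 - (σ' (0 - 1)).1))) / 2 := by
    simp only [energyDensityZ]
    ring
  rw [he]
  have hhalf : |((P.V ((σ (0 + 1)).1 - (σ 0).1) - P.V ((σ' (0 + 1)).1 - (σ' 0).1)) +
      (P.V ((σ 0).1 - (σ (0 - 1)).1) - P.V ((σ' 0).1 - (σ' (0 - 1)).1))) / 2| ≤ 6 * CV * Y ^ d * δ := by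
    rw [abs_div, abs_of_pos (by norm_num : (0 : ℝ) < 2), div_le_iff₀ (by norm_num : (0 : ℝ) < 2)]
    have := abs_add_le (P.V ((σ (0 + 1)).1 - (σ 0).1) - P.V ((σ' (0 + 1)).1 - (σ' 0).1))
      (P.V ((σ 0).1 - (σ (0 - 1)).1) - P.V ((σ' 0).1 - (σ' (0 - 1)).1))
    linarith
  calc |((σ 0).2 ^ 2 / 2 - (σ' 0).2 ^ 2 / 2) + (P.U (σ 0).1 - P.U (σ' 0).1) +
        ((P.V ((σ (0 + 1)).1 - (σ 0).1) - P.V ((σ' (0 + 1)).1 - (σ' 0).1)) +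
          (P.V ((σ 0).1 - (σ (0 - 1)).1) - P.V ((σ' 0).1 - (σ' (0 - 1)).1))) / 2|
      ≤ |(σ 0).2 ^ 2 / 2 - (σ' 0).2 ^ 2 / 2| + |P.U (σ 0).1 - P.U (σ' 0).1| +
          |((P.V ((σ (0 + 1)).1 - (σ 0).1) - P.V ((σ' (0 + 1)).1 - (σ' 0).1)) +
            (P.V ((σ 0).1 - (σ (0 - 1)).1) - P.V ((σ' 0).1 - (σ' (0 - 1)).1))) / 2| :=
        abs_add_three _ _ _
    _ ≤ 2 * Y ^ d * δ + 3 * CU * Y ^ d * δ + 6 * CV * Y ^ d * δ := add_le_add (add_le_add hkin hpin) hhalf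
    _ = (2 + 3 * CU + 6 * CV) * Y ^ d * δ := by ring
    _ = (2 + 3 * CU + 6 * CV) * 4 ^ (2 * s₁ + 2 * s₂ + 1) * R ^ (2 * s₁ + 2 * s₂ + 1) * δ := by
        rw [hY, mul_pow]; ring

end OscillatorChain

end Literature.MathematicalPhysics.KineticTheory.HeatConduction

end
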